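import Summits.ValiantsHypothesis.ValiantsHypothesis.Theorems.FifoMatchingNNDivisionHardExactPencilSparsePins
import HarnessLib

/-!
# EXACT PENCILS X — the RATE in `n` (standard blocks) with ★★★ `cor_add_sparseCube_decided`, and FORCED-OUT SETS (dead blocks `D`, faces `F_{Z,β}`): the engine `cor_add_bound_of_commonMaxD` (crux `NNDivisionHard`, stmt-ValiantsHypothesis-21181) — `ExactPencil` port part 10/12

Theorems-side port (staged by val-idea-40 g6, C′-census owner per director-valiant R331 (2)(e) / desk #399, for the port hands;
press as `Theorems/FifoMatchingNNDivisionHardExactPencilDeadBlocks.lean`, `--kind proof --supports stmt-ValiantsHypothesis-21181 --as helper`; sig-first val-idea-crit-9 g3) of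
§12b and §12c (first half: through `cor_add_bound_of_commonMaxD`) of val-idea-38 g2's crux workfile `Cruxes/NNDivisionHard/ExactPencil38.lean` REV 16 @4e81d1716f6b (sha16 d9f2e288279a0b09, 3 456 l., FROZEN — final from 38 g2, bus 01:14:51Z; critic of record val-idea-crit-9 g2/g3: `CRITIC-wave6.md` FINAL + V#97 §2 «rev 14/15 δ KERNEL VERIFIED»).  Declaration texts VERBATIM (namespace
`…Theorems.FifoMatching.ExactPencil`; one-line docstrings added where the source had none); the 40-g5 tools the source RESTATED are
DROPPED here and cited BY NAME from the landed ports `…Theorems.FifoMatching.LocatedRows.*` (✓ p680125 … p683387: `T`, `RowFamily`,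
`hCOR`, `exactTilted`, `ExactPencilLaw`, `pinnedRows`, `unflat`, `three_pow_le_of_block`, `two_pow_half_mul_le`, `zgen`, `cubePt`, …) and
`…Theorems.FifoMatching.XcDivision` (`udRow`, `udPt`, `udInd`, `udMat`, …), so that C′ stays ONE Theorems declaration
`LocatedRows.ExactPencilLaw`.  Part 10/12 of the port (imports part 9, `…Theorems.FifoMatchingNNDivisionHardExactPencilSparsePins`).

* §12b `βstd`, `σstd`, `βstd_σstd`, `le_bsize_βstd`, `T_lt_of_block_div` (rate `3^{⌊n/s⌋} ≤ (r+1)·2^{⌊n/s⌋} ⟹ T c n < r`), ★★★ `cor_add_sparseCube_decided`;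
* §12c `faceZeroD` (+ closure lemmas, `faceZero.toD`), `Es` (single-entry reader), `flat_Es_dotProduct_flat/udPt`, `Es_faceZeroD`, `diagD` (`I_Z`), `WD` (`W^β − I_Z`),
  `WD_dotProduct_udPt/bUn/udPt_le`, ★ `WD_face_or_le_neg_one` (the live face is exposed with margin 1), ★★ `cor_add_bound_of_commonMaxD`
  (`3^{k−|D|} ≤ (r+1)·2^{k−|D|}` from ONE passenger point maximising every located row).

HONEST LABEL: every theorem here is a DECIDED SPECIES / support lemma for the OPEN law C′ = `LocatedRows.ExactPencilLaw`
(`exactTilted.Law`); the crux 21181 `NNDivisionHard`, C′, `allRows.Law` and COR-VIRTUAL are OPEN; C⁺_entry `LocatedPencilLaw` is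
REFUTED (✓ p679540).  VP ≠ VNP is NOT proved here or anywhere in this tree.
-/

set_option autoImplicit false

-- the mandated summit-side namespace repeats a component by design (single-problem summit)
set_option linter.dupNamespace false

noncomputable section

open Matrix Finset
open scoped Pointwise

namespace Summit.ValiantsHypothesis.ValiantsHypothesis.Theorems.FifoMatching.ExactPencil

open Literature.Barriers.PneNP (HasEFOfSize three_pow_le_card_mul_two_pow_of_cover_univ)
open Summit.ValiantsHypothesis.ValiantsHypothesis.Theorems.FifoMatching.GridCorShadow (four_T_lt_two_pow)
open Literature.Combinatorics.Optimization.FixedSizePsdRank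
  (corPolytope flat vecOuter flat_dotProduct_le_of_mem_corPolytope flat_dotProduct_vecOuter)
open Summit.ValiantsHypothesis.ValiantsHypothesis.Theorems.FifoMatching.XcDivision
  (udRow udPt udInd udMat ud_data udInd_apply udInd_sq dot_le_of_mem_convexHull flat_dotProduct_flat)
open Summit.ValiantsHypothesis.ValiantsHypothesis.Theorems.FifoMatching.LocatedRows
  (T CorVirtualHardN RowFamily corVirtualHardN_of_law flat_le_box entryTilted allRows LocatedPencilLaw
    hCOR le_hCOR exists_eq_hCOR flat_le_hCOR hCOR_le_box exactTilted ExactPencilLaw exactTilted_emb_allRows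
    corVirtualHardN_of_exactPencilLaw three_pow_le_of_block two_pow_half_mul_le pinnedRows unflat flat_unflat
    pinnedRows_emb_exactTilted corVirtualHardN_of_pinnedRowsLaw zgen cubePt dotProduct_cubePt)

/-! ### §12b the rate in `n`: standard blocks of size `≥ s`, `k = ⌊n/s⌋`, and `T c n < r` eventually -/

section SparseRate

/-- the standard block assignment `x ↦ min(⌊x/s⌋, ⌊n/s⌋ − 1)` (the last block absorbs the remainder). -/
def βstd {n s : ℕ} (hs : 0 < s) (hns : s ≤ n) : Fin n → Fin (n / s) := fun x =>
  ⟨min (x.val / s) (n / s - 1), by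
    have : 1 ≤ n / s := (Nat.le_div_iff_mul_le hs).mpr (by simpa using hns)
    omega⟩

/-- representatives `i ↦ i·s`. -/
def σstd {n s : ℕ} (hs : 0 < s) (hns : s ≤ n) : Fin (n / s) → Fin n := fun i =>
  ⟨i.val * s, by
    have h1 : (i.val + 1) * s ≤ n / s * s := Nat.mul_le_mul_right s (Nat.succ_le_of_lt i.isLt)
    have h2 : n / s * s ≤ n := Nat.div_mul_le_self n s
    have _ := hns
    nlinarith⟩

/-- `σstd` is a section of `βstd`: `βstd (σstd i) = i`. -/
theorem βstd_σstd {n s : ℕ} (hs : 0 < s) (hns : s ≤ n) (i : Fin (n / s)) : βstd hs hns (σstd hs hns i) = i := by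
  apply Fin.ext
  show min (i.val * s / s) (n / s - 1) = i.val
  rw [Nat.mul_div_cancel _ hs]
  have := i.isLt
  omega

/-- every standard block has at least `s` elements. -/
theorem le_bsize_βstd {n s : ℕ} (hs : 0 < s) (hns : s ≤ n) (i : Fin (n / s)) : s ≤ bsize (βstd hs hns) i := by
  classical
  have hi := i.isLt
  have hbound : ∀ j : Fin s, i.val * s + j.val < n := by
    intro j
    have h1 : (i.val + 1) * s ≤ n / s * s := Nat.mul_le_mul_right s (Nat.succ_le_of_lt hi)
    have h2 : n / s * s ≤ n := Nat.div_mul_le_self n s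
    have h3 := j.isLt
    nlinarith
  let emb : Fin s → Fin n := fun j => ⟨i.val * s + j.val, hbound j⟩
  have hemb : Function.Injective emb := by
    intro j j' h
    have : i.val * s + j.val = i.val * s + j'.val := congrArg Fin.val h
    exact Fin.ext (by omega)
  have hβ : ∀ j : Fin s, βstd hs hns (emb j) = i := by
    intro j
    apply Fin.ext
    show min ((i.val * s + j.val) / s) (n / s - 1) = i.val
    have : (i.val * s + j.val) / s = i.val := by
      rw [add_comm, Nat.add_mul_div_right _ _ hs, Nat.div_eq_of_lt j.isLt, zero_add]
    rw [this]
    omega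
  have hsub : (Finset.univ : Finset (Fin s)).image emb ⊆ Finset.univ.filter (fun y => βstd hs hns y = i) := by
    intro y hy
    obtain ⟨j, -, rfl⟩ := Finset.mem_image.mp hy
    exact Finset.mem_filter.mpr ⟨Finset.mem_univ _, hβ j⟩
  have hcard : ((Finset.univ : Finset (Fin s)).image emb).card = s := by
    rw [Finset.card_image_of_injective _ hemb, Finset.card_univ, Fintype.card_fin]
  unfold bsize
  calc s = ((Finset.univ : Finset (Fin s)).image emb).card := hcard.symm
    _ ≤ _ := Finset.card_le_card hsub

/-- RATE: `3^{⌊n/s⌋} ≤ (r+1)·2^{⌊n/s⌋} ⟹ T c n < r`, eventually in `n` (for fixed `s ≥ 1`). -/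
theorem T_lt_of_block_div (s : ℕ) (hs : 0 < s) (c : ℕ) :
    ∃ n₀ : ℕ, ∀ n ≥ n₀, ∀ r : ℕ, 3 ^ (n / s) ≤ (r + 1) * 2 ^ (n / s) → T c n < r := by
  have hc₀ : (0 : ℝ) < 1 / (5 * s) := by
    have : (0 : ℝ) < s := by exact_mod_cast hs
    positivity
  obtain ⟨t₁, ht₁⟩ := four_T_lt_two_pow c hc₀
  refine ⟨max t₁ (2 * s), fun n hn r hr => ?_⟩
  have hn2 : 2 * s ≤ n := le_of_max_le_right hn
  have hq : 2 ≤ n / s := (Nat.le_div_iff_mul_le hs).mpr (by linarith)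
  have hdiv : n ≤ 5 * s * (n / s / 2) := by
    have h1 : n < n / s * s + s := Nat.lt_div_mul_add hs
    have h2 : n / s ≤ 2 * (n / s / 2) + 1 := by omega
    have hp : 1 ≤ n / s / 2 := by omega
    have h3 : n / s * s ≤ (2 * (n / s / 2) + 1) * s := Nat.mul_le_mul_right s h2
    have h4 : s ≤ (n / s / 2) * s := Nat.le_mul_of_pos_left s hp
    nlinarith
  have hreal : (1 / (5 * s) : ℝ) * n ≤ ((n / s / 2 : ℕ) : ℝ) := by
    have hs' : (0 : ℝ) < s := by exact_mod_cast hs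
    have : (n : ℝ) ≤ 5 * s * ((n / s / 2 : ℕ) : ℝ) := by exact_mod_cast hdiv
    rw [div_mul_eq_mul_div, one_mul, div_le_iff₀ (by positivity)]
    linarith
  have h4 := ht₁ n (le_of_max_le_left hn) (n / s / 2) hreal
  have hpow : 2 ^ (n / s / 2) * 2 ^ (n / s) ≤ (r + 1) * 2 ^ (n / s) := (two_pow_half_mul_le (n / s)).trans hr
  have hle : 2 ^ (n / s / 2) ≤ r + 1 := Nat.le_of_mul_le_mul_right hpow (Nat.pos_of_ne_zero (by positivity))
  show 2 ^ ((Nat.log 2 n + c) ^ c) < r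
  have hT' : (1 : ℕ) ≤ 2 ^ ((Nat.log 2 n + c) ^ c) := Nat.one_le_two_pow
  omega

/-- ★★★ **EVERY SPARSE-GENERATOR CUBE IS DECIDED AT THE TOP LAW**, eventually in `n`, for any fixed column-support bound `s`. -/
theorem cor_add_sparseCube_decided (s c : ℕ) (hs : 0 < s) : ∃ n₀ : ℕ, ∀ n ≥ n₀, ∀ (N : ℕ) (Q₀ : Matrix (Fin n) (Fin n) ℝ)
    (G : Fin N → Matrix (Fin n) (Fin n) ℝ) (Vs : Fin N → Finset (Fin n)),
    (∀ t x y, G t x y ≠ 0 → y ∈ Vs t) → (∀ t, (Vs t).card < s) → ∀ r : ℕ,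
    HasEFOfSize (corPolytope n + convexHull ℝ (Set.range (cubePt Q₀ G))) r → T c n < r := by
  obtain ⟨n₀, hn₀⟩ := T_lt_of_block_div s hs c
  refine ⟨max n₀ s, fun n hn N Q₀ G Vs hG hVs r hEF => hn₀ n (le_of_max_le_left hn) r ?_⟩
  have hns : s ≤ n := le_of_max_le_right hn
  exact cor_add_sparseCube_bound (βstd_σstd hs hns) Q₀ G Vs hG (fun t i => lt_of_lt_of_le (hVs t) (le_bsize_βstd hs hns i)) r hEF

end SparseRate

/-! ### §12c FORCED-OUT SETS (dead blocks; memo §2g faces `F_{Z,β}`): `Z := β⁻¹(D)`, live face `{b_S : S ∩ D = ∅}` exposed by `W^β − I_Z`,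
new readers `E_{xy}` with a dead row or column, the engine over the `k − |D|` live blocks, and genericity in EDGE form (cone certificates). -/

section DeadBlocks

variable {n k : ℕ}

/-- directions vanishing on the live part of the together face. -/
def faceZeroD (β : Fin n → Fin k) (D : Finset (Fin k)) (V : Matrix (Fin n) (Fin n) ℝ) : Prop :=
  ∀ S : Finset (Fin k), Disjoint S D → flat V ⬝ᵥ udPt (bUn β S) = 0

/-- `0` is face-zero relative to the dead set `D`. -/
theorem faceZeroD_zero (β : Fin n → Fin k) (D : Finset (Fin k)) : faceZeroD β D 0 := fun S _ => by
  rw [ShadowConstRead.flat_zero₄₁, zero_dotProduct]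

/-- `D`-face-zero directions are closed under addition. -/
theorem faceZeroD_add {β : Fin n → Fin k} {D : Finset (Fin k)} {V V' : Matrix (Fin n) (Fin n) ℝ}
    (h : faceZeroD β D V) (h' : faceZeroD β D V') : faceZeroD β D (V + V') := fun S hS => by
  rw [LocatedRows.flat_add', add_dotProduct, h S hS, h' S hS, add_zero]

/-- `D`-face-zero directions are closed under scalars. -/
theorem faceZeroD_smul {β : Fin n → Fin k} {D : Finset (Fin k)} {V : Matrix (Fin n) (Fin n) ℝ} (c : ℝ)
    (h : faceZeroD β D V) : faceZeroD β D (c • V) := fun S hS => by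
  rw [LocatedRows.flat_smul', smul_dotProduct, h S hS, smul_zero]

/-- face-zero implies `D`-face-zero for every `D`. -/
theorem faceZero.toD {β : Fin n → Fin k} (D : Finset (Fin k)) {V : Matrix (Fin n) (Fin n) ℝ} (h : faceZero β V) :
    faceZeroD β D V := fun S _ => h S

/-- the single-entry matrix `E_{xy}`. -/
def Es (x y : Fin n) : Matrix (Fin n) (Fin n) ℝ := fun p q => if p = x then (if q = y then (1 : ℝ) else 0) else 0

/-- the single-entry reader `E_{xy}` reads `g x y`. -/
theorem flat_Es_dotProduct_flat (x y : Fin n) (g : Matrix (Fin n) (Fin n) ℝ) : flat (Es x y) ⬝ᵥ flat g = g x y := by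
  classical
  rw [flat_dotProduct_flat]
  have h : ∀ p, ∑ q, Es x y p q * g p q = if p = x then g x y else 0 := by
    intro p
    unfold Es
    by_cases hp : p = x
    · subst hp
      simp only [if_true, ite_mul, one_mul, zero_mul, Finset.sum_ite_eq', Finset.mem_univ]
    · simp [hp]
  rw [Finset.sum_congr rfl fun p _ => h p, Finset.sum_ite_eq' Finset.univ x, if_pos (Finset.mem_univ x)]

/-- `⟨E_{xy}, x_b⟩ = [x ∈ b][y ∈ b]`. -/
theorem flat_Es_dotProduct_udPt (x y : Fin n) (b : Finset (Fin n)) :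
    flat (Es x y) ⬝ᵥ udPt b = if x ∈ b then (if y ∈ b then (1 : ℝ) else 0) else 0 := by
  classical
  rw [flat_dotProduct_udPt_sum]
  have h : ∀ p ∈ b, ∑ q ∈ b, Es x y p q = if p = x then (if y ∈ b then (1 : ℝ) else 0) else 0 := by
    intro p _
    unfold Es
    by_cases hp : p = x
    · subst hp
      simp only [if_true, Finset.sum_ite_eq']
    · simp [hp]
  rw [Finset.sum_congr rfl h, Finset.sum_ite_eq' b x]

/-- ★ NEW READERS: an entry with a dead row or a dead column is face-zero for the live face. -/
theorem Es_faceZeroD (β : Fin n → Fin k) (D : Finset (Fin k)) {x y : Fin n} (hdead : β x ∈ D ∨ β y ∈ D) :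
    faceZeroD β D (Es x y) := by
  intro S hS
  rw [flat_Es_dotProduct_udPt]
  have key : ∀ z : Fin n, β z ∈ D → z ∉ bUn β S := fun z hz hzS =>
    Finset.disjoint_left.mp hS ((mem_bUn β S z).mp hzS) hz
  rcases hdead with hx | hy
  · rw [if_neg (key x hx)]
  · by_cases hxb : x ∈ bUn β S
    · rw [if_pos hxb, if_neg (key y hy)]
    · rw [if_neg hxb]

/-- the dead diagonal `I_Z`, `Z = β⁻¹(D)`. -/
def diagD (β : Fin n → Fin k) (D : Finset (Fin k)) : Matrix (Fin n) (Fin n) ℝ :=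
  Matrix.diagonal (fun z => if β z ∈ D then (1 : ℝ) else 0)

/-- `⟨I_Z, x_b⟩ = |b ∩ Z|` for the dead-coordinate diagonal `I_Z`, `Z = β⁻¹(D)`. -/
theorem diagD_dotProduct_udPt (β : Fin n → Fin k) (D : Finset (Fin k)) (b : Finset (Fin n)) :
    flat (diagD β D) ⬝ᵥ udPt b = ((b.filter (fun z => β z ∈ D)).card : ℝ) := by
  classical
  unfold diagD
  rw [(ud_data n).2.2.2, Finset.sum_boole]

/-- the exposing direction of the live face: `W^β − I_Z`. -/
def WD (β : Fin n → Fin k) (D : Finset (Fin k)) : Matrix (Fin n) (Fin n) ℝ := Wtog β - diagD β D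

/-- `⟨W^β − I_Z, x_b⟩ = ⟨W^β, x_b⟩ − |b ∩ Z|`. -/
theorem WD_dotProduct_udPt (β : Fin n → Fin k) (D : Finset (Fin k)) (b : Finset (Fin n)) :
    flat (WD β D) ⬝ᵥ udPt b = flat (Wtog β) ⬝ᵥ udPt b - ((b.filter (fun z => β z ∈ D)).card : ℝ) := by
  unfold WD
  rw [LocatedRows.flat_sub', sub_dotProduct, diagD_dotProduct_udPt]

/-- `W^β − I_Z` reads `0` on the live together-face vertices `bUn β S`, `S ∩ D = ∅`. -/
theorem WD_dotProduct_bUn (β : Fin n → Fin k) {D S : Finset (Fin k)} (hS : Disjoint S D) :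
    flat (WD β D) ⬝ᵥ udPt (bUn β S) = 0 := by
  classical
  rw [WD_dotProduct_udPt, Wtog_dotProduct_bUn]
  have : (bUn β S).filter (fun z => β z ∈ D) = ∅ := by
    apply Finset.filter_false_of_mem
    intro z hz hzD
    exact Finset.disjoint_left.mp hS ((mem_bUn β S z).mp hz) hzD
  rw [this, Finset.card_empty, Nat.cast_zero, sub_zero]

/-- `⟨W^β − I_Z, x_b⟩ ≤ 0` at every vertex. -/
theorem WD_dotProduct_udPt_le (β : Fin n → Fin k) (D : Finset (Fin k)) (b : Finset (Fin n)) :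
    flat (WD β D) ⬝ᵥ udPt b ≤ 0 := by
  rw [WD_dotProduct_udPt]
  have h1 := Wtog_dotProduct_udPt_le β b
  have h2 : (0 : ℝ) ≤ ((b.filter (fun z => β z ∈ D)).card : ℝ) := Nat.cast_nonneg _
  linarith

/-- ON/OFF the live face: either `b` is a live union of blocks, or `W^β − I_Z` reads `≤ −1`. -/
theorem WD_face_or_le_neg_one (β : Fin n → Fin k) (D : Finset (Fin k)) (b : Finset (Fin n)) :
    (∃ S, Disjoint S D ∧ b = bUn β S) ∨ flat (WD β D) ⬝ᵥ udPt b ≤ -1 := by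
  classical
  by_cases hb : ∀ x y, β x = β y → x ∈ b → y ∈ b
  · by_cases hD : Disjoint (b.image β) D
    · exact Or.inl ⟨b.image β, hD, eq_bUn_image β hb⟩
    · right
      obtain ⟨i, hiS, hiD⟩ := Finset.not_disjoint_iff.mp hD
      obtain ⟨x, hxb, rfl⟩ := Finset.mem_image.mp hiS
      have hcard : 1 ≤ (b.filter (fun z => β z ∈ D)).card :=
        Finset.card_pos.mpr ⟨x, Finset.mem_filter.mpr ⟨hxb, hiD⟩⟩
      have hcard' : (1 : ℝ) ≤ ((b.filter (fun z => β z ∈ D)).card : ℝ) := by exact_mod_cast hcard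
      rw [WD_dotProduct_udPt]
      have h1 := Wtog_dotProduct_udPt_le β b
      linarith
  · right
    push Not at hb
    obtain ⟨x, y, hβ, hx, hy⟩ := hb
    rw [WD_dotProduct_udPt]
    have h1 : flat (Wtog β) ⬝ᵥ udPt b ≤ -1 := Wtog_dotProduct_udPt_le_neg_one β hx hy hβ
    have h2 : (0 : ℝ) ≤ ((b.filter (fun z => β z ∈ D)).card : ℝ) := Nat.cast_nonneg _
    linarith

/-- ★★ the ENGINE over the LIVE blocks: tightness on the live face and a common maximiser give `3^{k−|D|} ≤ (r+1)·2^{k−|D|}`. -/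
theorem cor_add_bound_of_commonMaxD {β : Fin n → Fin k} {σ : Fin k → Fin n} (hβσ : ∀ i, β (σ i) = i) (D : Finset (Fin k))
    {ι : Type*} [Fintype ι] (q : ι → (Fin (n * n) → ℝ)) (W : Matrix (Fin n) (Fin n) ℝ)
    (htight : ∀ S : Finset (Fin k), Disjoint S D → flat W ⬝ᵥ udPt (bUn β S) = hCOR W) (jstar : ι)
    (hmax : ∀ (a : Finset (Fin n)) (j : ι), (udRow a + flat W) ⬝ᵥ q j ≤ (udRow a + flat W) ⬝ᵥ q jstar) (r : ℕ)
    (hEF : HasEFOfSize (corPolytope n + convexHull ℝ (Set.range q)) r) :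
    3 ^ (k - D.card) ≤ (r + 1) * 2 ^ (k - D.card) := by
  classical
  obtain ⟨pt_mem, -, -, -⟩ := ud_data n
  have hne : (Finset.univ : Finset ι).Nonempty := ⟨jstar, Finset.mem_univ _⟩
  let mm : exactTilted.A n → ℝ := fun a => Finset.univ.sup' hne (fun j : ι => exactTilted.ρ n a ⬝ᵥ q j)
  have hle : ∀ a j, exactTilted.ρ n a ⬝ᵥ q j ≤ mm a := fun a j =>
    Finset.le_sup' (fun j : ι => exactTilted.ρ n a ⬝ᵥ q j) (Finset.mem_univ j)
  have hm : ∀ a, ∀ y ∈ convexHull ℝ (Set.range q), exactTilted.ρ n a ⬝ᵥ y ≤ mm a := fun a =>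
    dot_le_of_mem_convexHull _ _ _ (by rintro _ ⟨j, rfl⟩; exact hle a j)
  have hq : ∀ j : ι, q j ∈ convexHull ℝ (Set.range q) := fun j => subset_convexHull ℝ _ ⟨j, rfl⟩
  have hv : ∀ p : Finset (Fin n) × ι, udPt p.1 + q p.2 ∈ corPolytope n + convexHull ℝ (Set.range q) :=
    fun p => Set.add_mem_add (pt_mem p.1) (hq p.2)
  have hvalid : ∀ a, ∀ x ∈ corPolytope n + convexHull ℝ (Set.range q), exactTilted.ρ n a ⬝ᵥ x ≤ exactTilted.β n a + mm a := by
    rintro a x ⟨p, hp, y, hy, rfl⟩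
    rw [dotProduct_add]
    exact add_le_add (exactTilted.valid n a p hp) (hm a y hy)
  obtain ⟨U, V, hU, hV, hfac⟩ := Literature.Barriers.PneNP.HasEFOfSize.exists_nonneg_factorization hEF
    (fun p : Finset (Fin n) × ι => udPt p.1 + q p.2) hv (exactTilted.ρ n) (fun a => exactTilted.β n a + mm a) hvalid
  let emb : {i : Fin k // i ∉ D} ↪ Fin k := Function.Embedding.subtype _
  let row : Finset {i : Fin k // i ∉ D} → exactTilted.A n := fun α' => ((α'.map emb).image σ, W)
  let col : Finset {i : Fin k // i ∉ D} → Finset (Fin n) × ι := fun S => (bUn β (S.map emb), jstar)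
  have hdisj : ∀ S : Finset {i : Fin k // i ∉ D}, Disjoint (S.map emb) D := by
    intro S
    rw [Finset.disjoint_left]
    rintro i hi
    obtain ⟨i', -, rfl⟩ := Finset.mem_map.mp hi
    exact i'.property
  have hmm : ∀ α', mm (row α') = (udRow ((α'.map emb).image σ) + flat W) ⬝ᵥ q jstar := by
    intro α'
    obtain ⟨j₀, -, hj₀⟩ := Finset.exists_mem_eq_sup' hne (fun j : ι => exactTilted.ρ n (row α') ⬝ᵥ q j)
    have h1 := hle (row α') jstar
    have h2 : exactTilted.ρ n (row α') ⬝ᵥ q j₀ ≤ (udRow ((α'.map emb).image σ) + flat W) ⬝ᵥ q jstar := hmax _ j₀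
    change mm (row α') = _ at hj₀
    rw [hj₀] at h1 ⊢
    exact le_antisymm h2 h1
  have key := three_pow_le_of_block (ι := Option (Fin r)) U V hU hV row col ?_
  · have hc : Fintype.card {i : Fin k // i ∉ D} = k - D.card := by
      rw [Fintype.card_subtype]
      have : (Finset.univ.filter (fun i : Fin k => i ∉ D)) = Finset.univ \ D := by
        ext i; simp
      rw [this, Finset.card_univ_sdiff, Fintype.card_fin]
    rw [hc] at key
    simpa [Fintype.card_option, Fintype.card_fin] using key
  · intro α' S
    rw [← hfac (row α') (bUn β (S.map emb), jstar), hmm α']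
    show ((1 + hCOR W) + (udRow ((α'.map emb).image σ) + flat W) ⬝ᵥ q jstar) -
        (udRow ((α'.map emb).image σ) + flat W) ⬝ᵥ (udPt (bUn β (S.map emb)) + q jstar) = (1 - ((α' ∩ S).card : ℝ)) ^ 2
    rw [dotProduct_add, add_dotProduct _ _ (udPt (bUn β (S.map emb))), htight _ (hdisj S), ← Finset.card_map emb,
      Finset.map_inter, ← ud_block_tog hβσ (α'.map emb) (S.map emb)]
    ring

end DeadBlocks

end Summit.ValiantsHypothesis.ValiantsHypothesis.Theorems.FifoMatching.ExactPencil
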